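import Summits.QuantumAdvantage.QuantumAdvantage.Theorems.SymplecticPurityDeqThesisBridge
import Summits.QuantumAdvantage.QuantumAdvantage.Theorems.SymplecticPurityGoldDefs

/-!
# Crux `DeqThesis`, line `Sketch` — stub `stub_goldBridge`: field-level ⇒ family-level local
# flatness for the two-Gold-map family

The field-level statement `GoldLocallyFlat'` of the line (the normalised two-Gold-map graph state
`2^{-n/2} Σ_y |y⟩|e((e⁻¹ y)³)⟩|e((e⁻¹ y)⁵)⟩` on `n + (n + n)` qubits is `2^{-δ n}`-flat against every
locally rotated Pauli string `⊗ᵢ uᵢ σ_{Sᵢ} uᵢ†`, `S ≠ I`, for every field `K` of order `2ⁿ`, every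
`n ≥ n₀` and every additive identification `e : K ≃+ 𝔽₂ⁿ`) implies the same flatness, with the same
rate `δ`, for the actual final states of the uniform witness family `goldFamily`
(`Theorems/SymplecticPurityGoldDefs.lean`) on the inputs `0ⁿ` of the good lengths `n = 2·3^k` — in
particular on inputs of unbounded length — GIVEN the two structural facts about `goldFamily` proved
in the sibling stub `stub_goldState` and taken here as hypotheses:

* (a) on `0ⁿ` the final state of `goldFamily` is the normalised graph state of the Boolean map
  `goldMap n` into the ancilla block;
* (b) for `n = 2·3^k` this map is the pair `(y³, y⁵)` of the field `K = 𝔽₂[X]/(Φ_{3^{k+1}})`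
  (`fact_irreducible_cubePoly`, `card_cubeField`) read through the power-basis coordinates
  `cubeEquiv k`.

Proof (verbatim the cube-family bridge `stub_bridge` of `SymplecticPurityDeqThesisBridge.lean`, one
register longer): pick `k` with `2·3^k ≥ max n₀ n₀'` (`le_two_mul_three_pow`), take `x = 0^{2·3^k}`
and `j` = all gates; rewrite the state by (a); transport (b) along the propositional equality
`2·3^k = |x|` (`stub_goldBridge_transport`); instantiate the field-level hypothesis at
`K = 𝔽₂[X]/(Φ_{3^{k+1}})` and the transported coordinates; the amplitudes agree by
`invSqrt2 ^ n = (√2ⁿ)⁻¹` (`invSqrt2_pow_eq_inv_pow`).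
-/

noncomputable section

set_option linter.dupNamespace false -- D-0017: single-problem summit ⇒ `QuantumAdvantage.QuantumAdvantage` by design

namespace Summit.QuantumAdvantage.QuantumAdvantage.Theorems.SymplecticPurity

open Matrix Finset Literature.Computability.QuantumComplexity Literature.Computability.Cryptography
  Literature.Barriers.QuantumAdvantage

/-- Transport of hypothesis (b) (`goldMap (2·3^k) = (y³, y⁵)` in the coordinates `cubeEquiv k`)
along `2·3^k = m`: `goldMap m` is the pair of Gold maps of `𝔽₂[X]/(Φ_{3^{k+1}})` in some additive
coordinates `e : 𝔽₂[X]/(Φ_{3^{k+1}}) ≃+ 𝔽₂^m`. -/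
theorem stub_goldBridge_transport
    (hMap : ∀ (k : ℕ) (y : Fin (2 * 3 ^ k) → Bool),
      goldMap (2 * 3 ^ k) y =
        Fin.append
          (fun l : Fin (2 * 3 ^ k) =>
            decide (cubeEquiv k (((cubeEquiv k).symm fun i => if y i then 1 else 0) ^ 3) l = 1))
          (fun l : Fin (2 * 3 ^ k) =>
            decide (cubeEquiv k (((cubeEquiv k).symm fun i => if y i then 1 else 0) ^ 5) l = 1)))
    (k : ℕ) {m : ℕ} (h : 2 * 3 ^ k = m) :
    ∃ e : AdjoinRoot (cubePoly k) ≃+ (Fin m → ZMod 2), ∀ y : Fin m → Bool,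
      goldMap m y =
        Fin.append
          (fun l : Fin m => decide (e ((e.symm fun i => if y i then 1 else 0) ^ 3) l = 1))
          (fun l : Fin m => decide (e ((e.symm fun i => if y i then 1 else 0) ^ 5) l = 1)) := by
  subst h
  exact ⟨cubeEquiv k, hMap k⟩

/-- **Stub `stub_goldBridge` of line `Sketch` (crux `DeqThesis`)**: given (a) the final state of
`goldFamily` on `0ⁿ` (the normalised graph state of `goldMap n`) and (b) the identification of
`goldMap (2·3^k)` with the pair of Gold maps `(y³, y⁵)` of `𝔽₂[X]/(Φ_{3^{k+1}})` in power-basis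
coordinates, the field-level local flatness `GoldLocallyFlat'` of the normalised two-Gold-map graph
state (all fields of order `2ⁿ`, all additive coordinates) implies the family-level local flatness
of `goldFamily` at the same rate on inputs of unbounded length (the inputs `0ⁿ`, `n = 2·3^k`, after
all gates). -/
theorem stub_goldBridge :
    (∀ x : List Bool, (∀ i, x.get i = false) → 0 < x.length →
      goldFamily.stateAfter x (goldGates x.length).length =
        fun z : QReg (x.length + (x.length + x.length)) =>
          if (fun j : Fin (x.length + x.length) => z (Fin.natAdd x.length j)) =
              goldMap x.length (fun i : Fin x.length => z (Fin.castAdd (x.length + x.length) i))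
          then invSqrt2 ^ x.length else 0) →
    (∀ (k : ℕ) (y : Fin (2 * 3 ^ k) → Bool),
      goldMap (2 * 3 ^ k) y =
        Fin.append
          (fun l : Fin (2 * 3 ^ k) => decide (cubeEquiv k (((cubeEquiv k).symm fun i => if y i then 1 else 0) ^ 3) l = 1))
          (fun l : Fin (2 * 3 ^ k) => decide (cubeEquiv k (((cubeEquiv k).symm fun i => if y i then 1 else 0) ^ 5) l = 1))) →
    (∃ δ : ℝ, 0 < δ ∧ ∃ n₀ : ℕ, ∀ n ≥ n₀, ∀ (K : Type) [Field K] [Fintype K], Fintype.card K = 2 ^ n →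
      ∀ e : K ≃+ (Fin n → ZMod 2),
      ∀ u : Fin (n + (n + n)) → Matrix Bool Bool ℂ, (∀ i, u i ∈ Matrix.unitaryGroup Bool ℂ) →
        ∀ S : Fin (n + (n + n)) → Pauli, S ≠ (fun _ => Pauli.I) →
          ‖star (fun w : QReg (n + (n + n)) =>
                if (fun j : Fin (n + n) => w (Fin.natAdd n j)) =
                    Fin.append
                      (fun l : Fin n => decide (e ((e.symm (fun i : Fin n => if w (Fin.castAdd (n + n) i) then 1 else 0)) ^ 3) l = 1))
                      (fun l : Fin n => decide (e ((e.symm (fun i : Fin n => if w (Fin.castAdd (n + n) i) then 1 else 0)) ^ 5) l = 1))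
                then ((Real.sqrt 2 ^ n)⁻¹ : ℂ) else 0) ⬝ᵥ
              (tensorAll (fun i => u i * (S i).mat * star (u i))).mulVec
                (fun w : QReg (n + (n + n)) =>
                if (fun j : Fin (n + n) => w (Fin.natAdd n j)) =
                    Fin.append
                      (fun l : Fin n => decide (e ((e.symm (fun i : Fin n => if w (Fin.castAdd (n + n) i) then 1 else 0)) ^ 3) l = 1))
                      (fun l : Fin n => decide (e ((e.symm (fun i : Fin n => if w (Fin.castAdd (n + n) i) then 1 else 0)) ^ 5) l = 1))
                then ((Real.sqrt 2 ^ n)⁻¹ : ℂ) else 0)‖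
            ≤ (2 : ℝ) ^ (-(δ * (n : ℝ)))) →
    (∃ δ : ℝ, 0 < δ ∧ ∀ n₀ : ℕ, ∃ x : List Bool, n₀ ≤ x.length ∧ ∃ j : ℕ,
      ∀ u : Fin (x.length + goldFamily.ancillas x.length) → Matrix Bool Bool ℂ,
        (∀ i, u i ∈ Matrix.unitaryGroup Bool ℂ) →
        ∀ S : Fin (x.length + goldFamily.ancillas x.length) → Pauli, S ≠ (fun _ => Pauli.I) →
          ‖star (goldFamily.stateAfter x j) ⬝ᵥ
              (tensorAll (fun i => u i * (S i).mat * star (u i))).mulVec (goldFamily.stateAfter x j)‖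
            ≤ (2 : ℝ) ^ (-(δ * (x.length : ℝ)))) := by
  rintro hState hMap ⟨δ, hδ, n₀, H⟩
  refine ⟨δ, hδ, fun n₀' => ?_⟩
  -- a good input length `2·3^k ≥ max n₀ n₀'` and the all-zero input of that length
  set k : ℕ := max n₀ n₀' with hkdef
  have hk : max n₀ n₀' ≤ 2 * 3 ^ k := le_two_mul_three_pow _
  obtain ⟨x, hxlen, hx⟩ : ∃ x : List Bool, x.length = 2 * 3 ^ k ∧ ∀ i, x.get i = false :=
    ⟨List.replicate (2 * 3 ^ k) false, List.length_replicate, fun i => by simp⟩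
  have hn : 0 < x.length := by rw [hxlen]; positivity
  refine ⟨x, ?_, (goldGates x.length).length, fun u hu S hS => ?_⟩
  · rw [hxlen]; exact (le_max_right _ _).trans hk
  -- the field `K = 𝔽₂[X]/(Φ_{3^{k+1}})` of order `2^{|x|}` and its transported power coordinates
  haveI : Fact (Irreducible (cubePoly k)) := fact_irreducible_cubePoly k
  letI : Fintype (AdjoinRoot (cubePoly k)) := Fintype.ofEquiv _ (cubeEquiv k).symm.toEquiv
  have hcard : Fintype.card (AdjoinRoot (cubePoly k)) = 2 ^ x.length := by rw [card_cubeField, hxlen]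
  obtain ⟨e, he⟩ := stub_goldBridge_transport hMap k hxlen.symm
  have hge : x.length ≥ n₀ := by rw [hxlen]; exact (le_max_left _ _).trans hk
  have key := H x.length hge (AdjoinRoot (cubePoly k)) hcard e u hu S hS
  -- the final state of the family on `0^{|x|}` is the field-level two-Gold-map graph state
  have hstate : goldFamily.stateAfter x (goldGates x.length).length =
      fun w : QReg (x.length + (x.length + x.length)) =>
        if (fun j : Fin (x.length + x.length) => w (Fin.natAdd x.length j)) =
            Fin.append
              (fun l : Fin x.length => decide (e ((e.symm (fun i : Fin x.length =>
                if w (Fin.castAdd (x.length + x.length) i) then 1 else 0)) ^ 3) l = 1))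
              (fun l : Fin x.length => decide (e ((e.symm (fun i : Fin x.length =>
                if w (Fin.castAdd (x.length + x.length) i) then 1 else 0)) ^ 5) l = 1))
        then ((Real.sqrt 2 ^ x.length)⁻¹ : ℂ) else 0 := by
    rw [hState x hx hn]
    funext w
    rw [he, invSqrt2_pow_eq_inv_pow]
  rw [hstate]
  exact key

end Summit.QuantumAdvantage.QuantumAdvantage.Theorems.SymplecticPurity
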